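import Literature.NumberTheory.Automorphic.UnitaryLatticeTreeFixedCosetFlags              -- ★ FILE 1 (this seat): the dictionary (A)(B)(I) `Fix_γ(U ⧸ K₀ ∕ K₁ ∕ K₀ ⊓ K₁) ≃` fixed self-dual ∕ type-`d` vertices ∕ flags; brings ★ `UnitaryLatticeTreeFixedCosetStrataDictionary`, ★ T1a `UnitaryLatticeTreeDefs`
import Literature.NumberTheory.Automorphic.UnitaryLatticeTreeSelfDualTransitiveOfTrace     -- ★ `exists_unitary_mapGL_stdLattice_eq_of_isSelfDualLattice_of_trace` (transitivity on self-dual vertices from the datum's trace); brings ★ `UnitaryLatticeTreeTypeTwoTransitive` (`forall_isVertexLattice_two_exists_mapGL_N₁_eq`, `isTree_latticeGraph_three_of_unramified`), ★ `UnitaryLatticeTreeApartment` (`type_of_lt_three`, `isVertexLattice_two_latt_diagonal_one_one`, `mapGL_stdLattice_of_mem_unitaryInt`), ★ `UnitaryLatticeTreeStar` (`not_isSelfDualLattice_of_isVertexLattice_two`)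
import Literature.NumberTheory.Automorphic.UnitaryLatticeTreeRootStarOrbit                   -- ★ `exists_mem_unitaryInt_eq_mapGL_N₁_of_lt`, `mapGL_N₁_lt_stdLattice` (the star of the root is the `K₀`-orbit of `N₁`)
import Literature.Combinatorics.SimpleGraph.TreeRootedCriterionFixedSubtree                  -- ★ `RootedTree.ncard_fixedPoints_eq_ncard_fixedEdges_add_one`, `RootedTree.exists_fixedPoint_of_finite_invariant`
import HarnessLib

/-!
# THE ELLIPTIC EULER–POINCARÉ RELATION `#Fix_γ(U⧸K₀) + #Fix_γ(U⧸K₁) = #Fix_γ(U⧸(K₀ ⊓ K₁)) + 1` ON THE `U(3)` LATTICE TREE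
# (Kottwitz 1988 §2; Serre, *Trees*, I.6.1 ∕ II.1.1; Bruhat–Tits 1972 §10) — the rank-3 twin of ★ `HermitianLatticeTreeEulerRelation.natCard_fixedBy_add_eq_natCard_fixedBy_inf_add_one`

Topic `NumberTheory/Automorphic`; namespace `Literature.NumberTheory.Automorphic.UnitaryLatticeTree`.  THEOREMS ONLY (no definition ∕ instance ∕ notation ∕ named fact ∕ `sorry`).
Cell `pub/hodgecm-mathlib`, crux H413 = `stmt-HodgeConjecture-24833` (`--supports` lane, helper), LH6 rung-0 residue, CENSUS «EP-G» v1 (F0P3a-p09 (g12)) §5 brick **(G2) «(E)-G»,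
ELLIPTIC HALF**, FILE 2 of 2: the relation (E) that the rank-generic ★ GLUE `Rogawski1990/RankOneEulerPoincareGlue.exists_isLocSmooth_classOrbitalIntegral_eq_one_zero_of_relations` consumes
to build Kottwitz's Euler–Poincaré function `f_EP^G = ν(K₀)⁻¹𝟙_{K₀} + ν(K₁)⁻¹𝟙_{K₁} − ν(I)⁻¹𝟙_I` of the quasi-split `G = U(3)` (`K₀`, `K₁` the two vertex stabilisers, `I = K₀ ⊓ K₁` the Iwahori)
on the ★ `U(3)` lattice tree of road «S3-tree».  Seat LH6-p03 (g8).  HONEST LABEL: count-neutral (a combinatorial letter about fixed cosets; nothing printed is asserted); HC_CM is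
proved only modulo the 7 printed citations (2 remaining named inputs hLiu418 = stmt-HodgeConjecture-24832, h413 = stmt-HodgeConjecture-24833) until rung 0 closes.

THE THEOREM (`natCard_fixedBy_add_eq_natCard_fixedBy_inf_add_one_three`).  `K` a field with `Valued K ℤᵐ⁰` (and the compatible `ValuativeRel`, for ★ `glInt`), an UNRAMIFIED datum
`hd : UnramifiedLocalConjDatum σ ϖ`, `J₀ = antidiag(1,1,1)`, `U := unitaryGroupOfForm σ J₀ ≤ GL₃(K)`, `K₀ := U ∩ GL₃(𝒪) = Stab_U(L₀)` (`L₀ = 𝒪³` the self-dual root), `g₁ = diag(1, 1, ϖ)`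
(`g₁·L₀ = N₁`, the standard type-two neighbour of the root), `K₁ := U ∩ g₁ GL₃(𝒪) g₁⁻¹ = Stab_U(N₁)`.  For every `γ ∈ U` with FINITELY many fixed cosets in `U ⧸ K₀` and in `U ⧸ K₁` and a
FINITE `⟨γ⟩`-orbit of the root coset (e.g. `γ` regular elliptic, ★ `finite_fixedBy_quotient_of_isClosed`): `Nat.card Fix_γ(U ⧸ K₀) + Nat.card Fix_γ(U ⧸ K₁) = Nat.card Fix_γ(U ⧸ (K₀ ⊓ K₁)) + 1`.
NO transitivity hypothesis is left: `U` is transitive on the self-dual vertices (★ `exists_unitary_mapGL_stdLattice_eq_of_isSelfDualLattice_of_trace`, datum's trace element), on the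
type-two vertices (★ `forall_isVertexLattice_two_exists_mapGL_N₁_eq`) and on the edges (`forall_flag_exists_unitary` below, from ★ `exists_mem_unitaryInt_eq_mapGL_N₁_of_lt`: the star of
the root is the `K₀`-orbit of `N₁`) — all three for every unramified datum.
PROOF (the rank-2 template, line by line): ★ FILE 1 (A) `Fix(U⧸K₀) ≃` fixed self-dual vertices, (B) `Fix(U⧸K₁) ≃` fixed type-two vertices, (I) `Fix(U⧸(K₀ ⊓ K₁)) ≃` fixed flags `M < L`
`≃` fixed edges of ★ `latticeGraph σ ϖ J₀` (an edge joins a type-two vertex to a self-dual vertex above it, ★ `type_of_lt_three`); the fixed vertices form a finite set, non-empty by ★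
`RootedTree.exists_fixedPoint_of_finite_invariant` (finite `γ`-stable orbit of the root, type colouring), and ★ `RootedTree.ncard_fixedPoints_eq_ncard_fixedEdges_add_one` on the tree
★ `isTree_latticeGraph_three_of_unramified`.
* `forall_flag_exists_unitary` (transitivity on edges), `nonempty_fixed_flags_equiv_fixed_edges_three` (fixed flags ≃ fixed edges), `exists_latticeGraphIso_apply_eq_self_three` (a fixed
  vertex), **`natCard_fixedBy_add_eq_natCard_fixedBy_inf_add_one_three`** (the relation).

## References
* [Kottwitz1988] R. E. Kottwitz, *Tamagawa numbers*, Ann. of Math. 127 (1988), §2 (Euler–Poincaré functions and fixed facets of the building).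
* [Serre1980Trees] J.-P. Serre, *Trees* (1980), I.6.1 (a group acting without inversion with a bounded orbit fixes a vertex), II.1.1 (lattice trees).
* [BruhatTits1972] F. Bruhat, J. Tits, *Groupes réductifs sur un corps local I*, Publ. IHÉS 41 (1972), §3.2, §10 (fixed points of bounded subgroups; unitary groups).
* [Tits1979] J. Tits, *Reductive groups over local fields*, PSPM 33.1 (1979), §2.4, §3.3.3 (the quasi-split `²A₂`: two vertex types, hyperspecial `K₀`).
* [Rogawski1990] J. D. Rogawski, *Automorphic representations of unitary groups in three variables*, Ann. of Math. Stud. 123 (1990), §12.3 p. 176 (Euler–Poincaré functions at non-split places), §12.6 p. 187.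
-/

set_option autoImplicit false

noncomputable section

open Matrix Literature.NumberTheory.Automorphic Literature.Combinatorics.SimpleGraph
open Literature.NumberTheory.Automorphic.HermitianLattice Literature.NumberTheory.Automorphic.UnitaryGroup Literature.NumberTheory.Automorphic.CartanUnique
open scoped Matrix MatrixGroups WithZero Valued

namespace Literature.NumberTheory.Automorphic.UnitaryLatticeTree

variable {K : Type*} [Field K] [Valued K ℤᵐ⁰] [ValuativeRel K] [(Valued.v : Valuation K ℤᵐ⁰).Compatible]

/-! ## §3 `N = 3`, `J₀ = antidiag(1,1,1)`, unramified datum: edges, a fixed vertex, and the Euler–Poincaré relation -/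

section Three

variable {σ : K →+* K} {ϖ : K}

omit [ValuativeRel K] [(Valued.v : Valuation K ℤᵐ⁰).Compatible] in
/-- **`U(σ, J₀)` IS TRANSITIVE ON THE EDGES** (flags `M < L`, `L` self-dual, `M` of type two) for every unramified datum: move `L` to the root by the self-dual transitivity
(★ `exists_unitary_mapGL_stdLattice_eq_of_isSelfDualLattice_of_trace`), then `M` into `N₁ = g₁·L₀` inside the star of the root by an element of `K₀` (★
`exists_mem_unitaryInt_eq_mapGL_N₁_of_lt`). [cite: BruhatTits1972, §10] [cite: Serre1980Trees, II.1.1] [cite: Tits1979, §3.3.3] -/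
theorem forall_flag_exists_unitary (hd : UnramifiedLocalConjDatum σ ϖ) (g₁ : GL (Fin 3) K) (hg₁ : (g₁ : Matrix (Fin 3) (Fin 3) K) = Matrix.diagonal ![(1 : K), 1, ϖ]) :
    ∀ L M : Submodule (Valued.integer K) (Fin 3 → K), IsSelfDualLattice σ ϖ ((StdForm.antidiagonal 3).over K) L → IsVertexLattice σ ϖ ((StdForm.antidiagonal 3).over K) 2 M → M < L →
      ∃ u : ↥(unitaryGroupOfForm σ ((StdForm.antidiagonal 3).over K)), mapGL (u : GL (Fin 3) K) (stdLattice K 3) = L ∧ mapGL ((u : GL (Fin 3) K) * g₁) (stdLattice K 3) = M := by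
  intro L M hL hM hlt
  obtain ⟨u₀, hu₀⟩ := exists_unitary_mapGL_stdLattice_eq_of_isSelfDualLattice_of_trace hd.σσ hd.vσ hd.vϖ hd.trace hL
  -- `u₀⁻¹·M < L₀` is a type-two vertex below the root, hence `κ·N₁` with `κ ∈ K₀`
  have hM' : IsVertexLattice σ ϖ ((StdForm.antidiagonal 3).over K) 2 (mapGL ((u₀⁻¹ : ↥(unitaryGroupOfForm σ ((StdForm.antidiagonal 3).over K))) : GL (Fin 3) K) M) :=
    isVertexLattice_mapGL σ ϖ _ _ (u₀⁻¹).2 hM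
  have hlt' : mapGL ((u₀⁻¹ : ↥(unitaryGroupOfForm σ ((StdForm.antidiagonal 3).over K))) : GL (Fin 3) K) M < stdLattice K 3 := by
    have h := (mapGL_lt_mapGL_iff ((u₀⁻¹ : ↥(unitaryGroupOfForm σ ((StdForm.antidiagonal 3).over K))) : GL (Fin 3) K) _ _).2 hlt
    rwa [← hu₀, ← mapGL_mul, Subgroup.coe_inv, inv_mul_cancel, mapGL_one] at h
  obtain ⟨κ, hκ, hκM⟩ := exists_mem_unitaryInt_eq_mapGL_N₁_of_lt hd hM' hlt'
  refine ⟨u₀ * κ, ?_, ?_⟩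
  · rw [Subgroup.coe_mul, mapGL_mul, mapGL_stdLattice_of_mem_unitaryInt hκ, hu₀]
  · have hN₁ : mapGL g₁ (stdLattice K 3) = latt (Matrix.diagonal ![(1 : K), 1, ϖ]) := by rw [← hg₁]; rfl
    rw [Subgroup.coe_mul, mapGL_mul, mapGL_mul, hN₁, ← hκM, ← mapGL_mul, Subgroup.coe_inv, mul_inv_cancel, mapGL_one]

omit [ValuativeRel K] [(Valued.v : Valuation K ℤᵐ⁰).Compatible] in
/-- **(I, flags → edges)** the `γ`-fixed flags `(L, M)` (`L` self-dual, `M` of type two, `M < L`) ≃ the `γ`-fixed edges of ★ `latticeGraph σ ϖ J₀`: an edge joins a type-two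
vertex to a self-dual vertex above it (★ `type_of_lt_three`), and no vertex is both (★ `not_isSelfDualLattice_of_isVertexLattice_two`). [cite: Serre1980Trees, II.1.1] [cite: BruhatTits1972, §10] -/
theorem nonempty_fixed_flags_equiv_fixed_edges_three (hd : UnramifiedLocalConjDatum σ ϖ) (γ : ↥(unitaryGroupOfForm σ ((StdForm.antidiagonal 3).over K))) :
    Nonempty ({p : {M : Submodule (Valued.integer K) (Fin 3 → K) // IsVertex σ ϖ ((StdForm.antidiagonal 3).over K) M} ×
        {M : Submodule (Valued.integer K) (Fin 3 → K) // IsVertex σ ϖ ((StdForm.antidiagonal 3).over K) M} //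
        IsSelfDualLattice σ ϖ ((StdForm.antidiagonal 3).over K) p.1.1 ∧ IsVertexLattice σ ϖ ((StdForm.antidiagonal 3).over K) 2 p.2.1 ∧ p.2.1 < p.1.1 ∧
          latticeGraphIso σ ϖ ((StdForm.antidiagonal 3).over K) γ p.1 = p.1 ∧ latticeGraphIso σ ϖ ((StdForm.antidiagonal 3).over K) γ p.2 = p.2} ≃
      ↥{e ∈ (latticeGraph σ ϖ ((StdForm.antidiagonal 3).over K)).edgeSet | ∀ v ∈ e, latticeGraphIso σ ϖ ((StdForm.antidiagonal 3).over K) γ v = v}) := by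
  classical
  have hnot : ∀ M : Submodule (Valued.integer K) (Fin 3 → K), IsVertexLattice σ ϖ ((StdForm.antidiagonal 3).over K) 2 M →
      ¬ IsSelfDualLattice σ ϖ ((StdForm.antidiagonal 3).over K) M := fun M h2 => not_isSelfDualLattice_of_isVertexLattice_two hd h2
  refine ⟨Equiv.ofBijective (fun p => ⟨s(p.1.1, p.1.2), ?_, ?_⟩) ⟨?_, ?_⟩⟩
  · rw [SimpleGraph.mem_edgeSet, latticeGraph_adj_iff]
    exact Or.inr p.2.2.2.1
  · intro v hv
    rw [Sym2.mem_iff] at hv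
    rcases hv with rfl | rfl
    · exact p.2.2.2.2.1
    · exact p.2.2.2.2.2
  · intro p q hpq
    have h : s(p.1.1, p.1.2) = s(q.1.1, q.1.2) := congrArg Subtype.val hpq
    rw [Sym2.eq_iff] at h
    rcases h with ⟨h1, h2⟩ | ⟨h1, h2⟩
    · exact Subtype.ext (Prod.ext h1 h2)
    · exact (hnot _ (by rw [h1]; exact q.2.2.1) p.2.1).elim
  · rintro ⟨e, he, hfix⟩
    induction e using Sym2.ind with
    | h a b =>
      rw [SimpleGraph.mem_edgeSet, latticeGraph_adj_iff] at he
      obtain ⟨da, ha⟩ := a.2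
      obtain ⟨db, hb⟩ := b.2
      rcases he with hlt | hlt
      · have ht := type_of_lt_three hd.vσ hd.vϖ v_det_antidiagonal_three ha hb hlt
        rw [ht.1] at ha
        rw [ht.2] at hb
        refine ⟨⟨(b, a), hb, ha, hlt, hfix b (Sym2.mem_mk_right a b), hfix a (Sym2.mem_mk_left a b)⟩, ?_⟩
        apply Subtype.ext
        exact Sym2.eq_swap
      · have ht := type_of_lt_three hd.vσ hd.vϖ v_det_antidiagonal_three hb ha hlt
        rw [ht.1] at hb
        rw [ht.2] at ha
        exact ⟨⟨(a, b), ha, hb, hlt, hfix a (Sym2.mem_mk_left a b), hfix b (Sym2.mem_mk_right a b)⟩, rfl⟩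

/-- **A vertex fixed by `γ`** exists as soon as the `⟨γ⟩`-orbit of the root coset `K₀` is finite (e.g. `γ` in a compact subgroup): the orbit of the root is a finite non-empty
`γ`-stable vertex set of the tree and `γ` preserves the type colouring (★ `RootedTree.exists_fixedPoint_of_finite_invariant`). [cite: Serre1980Trees, I.6.1] [cite: BruhatTits1972, §3.2] -/
theorem exists_latticeGraphIso_apply_eq_self_three (hd : UnramifiedLocalConjDatum σ ϖ) (γ : ↥(unitaryGroupOfForm σ ((StdForm.antidiagonal 3).over K)))
    (horb : (Set.range fun n : ℕ => ((γ ^ n : ↥(unitaryGroupOfForm σ ((StdForm.antidiagonal 3).over K))) :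
      ↥(unitaryGroupOfForm σ ((StdForm.antidiagonal 3).over K)) ⧸ (glInt 3 K).subgroupOf (unitaryGroupOfForm σ ((StdForm.antidiagonal 3).over K)))).Finite) :
    ∃ v : {M : Submodule (Valued.integer K) (Fin 3 → K) // IsVertex σ ϖ ((StdForm.antidiagonal 3).over K) M}, latticeGraphIso σ ϖ ((StdForm.antidiagonal 3).over K) γ v = v := by
  classical
  have hT := isTree_latticeGraph_three_of_unramified (K := K) hd
  have hroot : IsSelfDualLattice σ ϖ ((StdForm.antidiagonal 3).over K) (stdLattice K 3) := isSelfDualLattice_stdLattice_three hd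
  have hnot : ∀ M : Submodule (Valued.integer K) (Fin 3 → K), IsVertexLattice σ ϖ ((StdForm.antidiagonal 3).over K) 2 M →
      ¬ IsSelfDualLattice σ ϖ ((StdForm.antidiagonal 3).over K) M := fun M h2 => not_isSelfDualLattice_of_isVertexLattice_two hd h2
  -- the type colouring: self-dual ↦ 0, type two ↦ 1
  have hval : ∀ v w : {M : Submodule (Valued.integer K) (Fin 3 → K) // IsVertex σ ϖ ((StdForm.antidiagonal 3).over K) M},
      (latticeGraph σ ϖ ((StdForm.antidiagonal 3).over K)).Adj v w →
        (if IsSelfDualLattice σ ϖ ((StdForm.antidiagonal 3).over K) v.1 then (0 : Fin 2) else 1) ≠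
          (if IsSelfDualLattice σ ϖ ((StdForm.antidiagonal 3).over K) w.1 then (0 : Fin 2) else 1) := by
    intro v w hvw
    rw [latticeGraph_adj_iff] at hvw
    obtain ⟨dv, hv⟩ := v.2
    obtain ⟨dw, hw⟩ := w.2
    rcases hvw with hlt | hlt
    · obtain ⟨rfl, rfl⟩ := type_of_lt_three hd.vσ hd.vϖ v_det_antidiagonal_three hv hw hlt
      rw [if_neg (hnot _ hv), if_pos hw]; decide
    · obtain ⟨rfl, rfl⟩ := type_of_lt_three hd.vσ hd.vϖ v_det_antidiagonal_three hw hv hlt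
      rw [if_pos hv, if_neg (hnot _ hw)]; decide
  let c : (latticeGraph σ ϖ ((StdForm.antidiagonal 3).over K)).Coloring (Fin 2) :=
    SimpleGraph.Coloring.mk (fun v => if IsSelfDualLattice σ ϖ ((StdForm.antidiagonal 3).over K) v.1 then (0 : Fin 2) else 1) (fun {v w} hvw => hval v w hvw)
  have hc : ∀ v, c (latticeGraphIso σ ϖ ((StdForm.antidiagonal 3).over K) γ v) = c v := by
    intro v
    change (if IsSelfDualLattice σ ϖ ((StdForm.antidiagonal 3).over K) (latticeGraphIso σ ϖ ((StdForm.antidiagonal 3).over K) γ v).1 then (0 : Fin 2) else 1) =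
      (if IsSelfDualLattice σ ϖ ((StdForm.antidiagonal 3).over K) v.1 then (0 : Fin 2) else 1)
    have h : IsSelfDualLattice σ ϖ ((StdForm.antidiagonal 3).over K) (latticeGraphIso σ ϖ ((StdForm.antidiagonal 3).over K) γ v).1 ↔
        IsSelfDualLattice σ ϖ ((StdForm.antidiagonal 3).over K) v.1 := isVertexLattice_mapGL_iff σ ϖ _ γ v.1
    rw [show (if IsSelfDualLattice σ ϖ ((StdForm.antidiagonal 3).over K) (latticeGraphIso σ ϖ ((StdForm.antidiagonal 3).over K) γ v).1 then (0 : Fin 2) else 1) =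
      (if IsSelfDualLattice σ ϖ ((StdForm.antidiagonal 3).over K) v.1 then (0 : Fin 2) else 1) from by simp only [h]]
  -- the orbit of the root as a vertex set
  let vA : ↥(unitaryGroupOfForm σ ((StdForm.antidiagonal 3).over K)) → {M : Submodule (Valued.integer K) (Fin 3 → K) // IsVertex σ ϖ ((StdForm.antidiagonal 3).over K) M} := fun u =>
    ⟨mapGL (u : GL (Fin 3) K) (stdLattice K 3), ⟨0, isVertexLattice_mapGL σ ϖ _ _ u.2 hroot⟩⟩
  let f : ↥(unitaryGroupOfForm σ ((StdForm.antidiagonal 3).over K)) ⧸ (glInt 3 K).subgroupOf (unitaryGroupOfForm σ ((StdForm.antidiagonal 3).over K)) →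
      {M : Submodule (Valued.integer K) (Fin 3 → K) // IsVertex σ ϖ ((StdForm.antidiagonal 3).over K) M} := fun x =>
    Quotient.liftOn' x vA (by
      intro a b hab
      apply Subtype.ext
      change mapGL _ _ = mapGL _ _
      rw [← mk_eq_mk_iff_mapGL_stdLattice_eq σ ((StdForm.antidiagonal 3).over K) a b]
      exact Quotient.sound' hab)
  have hf : ∀ u : ↥(unitaryGroupOfForm σ ((StdForm.antidiagonal 3).over K)),
      f (u : ↥(unitaryGroupOfForm σ ((StdForm.antidiagonal 3).over K)) ⧸ (glInt 3 K).subgroupOf (unitaryGroupOfForm σ ((StdForm.antidiagonal 3).over K))) = vA u := fun u => rfl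
  refine RootedTree.exists_fixedPoint_of_finite_invariant hT (latticeGraphIso σ ϖ ((StdForm.antidiagonal 3).over K) γ) c hc
    (S := f '' Set.range fun n : ℕ => ((γ ^ n : ↥(unitaryGroupOfForm σ ((StdForm.antidiagonal 3).over K))) :
      ↥(unitaryGroupOfForm σ ((StdForm.antidiagonal 3).over K)) ⧸ (glInt 3 K).subgroupOf (unitaryGroupOfForm σ ((StdForm.antidiagonal 3).over K))))
    (horb.image f) ⟨f ((γ ^ 0 : ↥(unitaryGroupOfForm σ ((StdForm.antidiagonal 3).over K))) :
      ↥(unitaryGroupOfForm σ ((StdForm.antidiagonal 3).over K)) ⧸ (glInt 3 K).subgroupOf (unitaryGroupOfForm σ ((StdForm.antidiagonal 3).over K))), Set.mem_image_of_mem f ⟨0, rfl⟩⟩ ?_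
  rintro s ⟨x, ⟨n, rfl⟩, rfl⟩
  refine ⟨((γ ^ (n + 1) : ↥(unitaryGroupOfForm σ ((StdForm.antidiagonal 3).over K))) :
    ↥(unitaryGroupOfForm σ ((StdForm.antidiagonal 3).over K)) ⧸ (glInt 3 K).subgroupOf (unitaryGroupOfForm σ ((StdForm.antidiagonal 3).over K))), ⟨n + 1, rfl⟩, ?_⟩
  rw [hf, hf]
  apply Subtype.ext
  rw [latticeGraphIso_apply_coe]
  change mapGL _ _ = mapGL _ (mapGL _ _)
  rw [← mapGL_mul, ← Subgroup.coe_mul, ← pow_succ']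

/-- **THE ELLIPTIC EULER–POINCARÉ RELATION ON THE `U(3)` TREE.**  `hd : UnramifiedLocalConjDatum σ ϖ` an unramified datum, `U = U(σ, J₀)(K)` the quasi-split unitary group of
`J₀ = antidiag(1,1,1)`, `K₀ = U ∩ GL₃(𝒪)` (the hyperspecial stabiliser of the self-dual root `L₀ = 𝒪³`), `g₁ = diag(1, 1, ϖ)` (so `g₁·L₀ = N₁`, the standard type-two neighbour of
the root) and `K₁ = U ∩ g₁ GL₃(𝒪) g₁⁻¹` (the stabiliser of `N₁`, the special non-hyperspecial vertex stabiliser), `K₀ ⊓ K₁` the Iwahori subgroup.  Then for every `γ ∈ U` with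
FINITELY many fixed cosets in `U ⧸ K₀` and in `U ⧸ K₁` and a FINITE `⟨γ⟩`-orbit of the root coset (e.g. `γ` regular elliptic: closed conjugacy class and compact centraliser, ★
`finite_fixedBy_quotient_of_isClosed`)
`#Fix_γ(U ⧸ K₀) + #Fix_γ(U ⧸ K₁) = #Fix_γ(U ⧸ (K₀ ⊓ K₁)) + 1`:
the `γ`-fixed vertices of the Bruhat–Tits tree ★ `latticeGraph σ ϖ J₀` (a tree, ★ `isTree_latticeGraph_three_of_unramified`) form a finite non-empty subtree, whose vertex count
(`= #Fix(U⧸K₀) + #Fix(U⧸K₁)` by the dictionary (A), (B) and the transitivity of `U` on the vertices of each type) exceeds its edge count (`= #Fix(U⧸(K₀ ⊓ K₁))`, (I), transitivity on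
edges) by one.  This is the elliptic relation (E) of ★ `Rogawski1990/RankOneEulerPoincareGlue.exists_isLocSmooth_classOrbitalIntegral_eq_one_zero_of_relations` for the quasi-split
`U(3)` at an unramified (inert) place — Kottwitz's count `Φ(γ, f_EP) = χ(𝒯^γ) = 1` for `γ` elliptic regular.
[cite: Kottwitz1988, §2] [cite: Serre1980Trees, I.6.1, II.1.1] [cite: BruhatTits1972, §10] [cite: Tits1979, §2.4, §3.3.3] [cite: Rogawski1990, §12.3 p. 176] -/
theorem natCard_fixedBy_add_eq_natCard_fixedBy_inf_add_one_three (hd : UnramifiedLocalConjDatum σ ϖ)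
    (g₁ : GL (Fin 3) K) (hg₁ : (g₁ : Matrix (Fin 3) (Fin 3) K) = Matrix.diagonal ![(1 : K), 1, ϖ])
    (γ : ↥(unitaryGroupOfForm σ ((StdForm.antidiagonal 3).over K)))
    (hK₀fin : (MulAction.fixedBy (↥(unitaryGroupOfForm σ ((StdForm.antidiagonal 3).over K)) ⧸
      (glInt 3 K).subgroupOf (unitaryGroupOfForm σ ((StdForm.antidiagonal 3).over K))) γ).Finite)
    (hK₁fin : (MulAction.fixedBy (↥(unitaryGroupOfForm σ ((StdForm.antidiagonal 3).over K)) ⧸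
      ((glInt 3 K).map (MulAut.conj g₁).toMonoidHom).subgroupOf (unitaryGroupOfForm σ ((StdForm.antidiagonal 3).over K))) γ).Finite)
    (horb : (Set.range fun n : ℕ => ((γ ^ n : ↥(unitaryGroupOfForm σ ((StdForm.antidiagonal 3).over K))) :
      ↥(unitaryGroupOfForm σ ((StdForm.antidiagonal 3).over K)) ⧸ (glInt 3 K).subgroupOf (unitaryGroupOfForm σ ((StdForm.antidiagonal 3).over K)))).Finite) :
    Nat.card (MulAction.fixedBy (↥(unitaryGroupOfForm σ ((StdForm.antidiagonal 3).over K)) ⧸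
        (glInt 3 K).subgroupOf (unitaryGroupOfForm σ ((StdForm.antidiagonal 3).over K))) γ) +
      Nat.card (MulAction.fixedBy (↥(unitaryGroupOfForm σ ((StdForm.antidiagonal 3).over K)) ⧸
        ((glInt 3 K).map (MulAut.conj g₁).toMonoidHom).subgroupOf (unitaryGroupOfForm σ ((StdForm.antidiagonal 3).over K))) γ) =
      Nat.card (MulAction.fixedBy (↥(unitaryGroupOfForm σ ((StdForm.antidiagonal 3).over K)) ⧸
        ((glInt 3 K).subgroupOf (unitaryGroupOfForm σ ((StdForm.antidiagonal 3).over K)) ⊓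
          ((glInt 3 K).map (MulAut.conj g₁).toMonoidHom).subgroupOf (unitaryGroupOfForm σ ((StdForm.antidiagonal 3).over K)))) γ) + 1 := by
  classical
  have hϖ0 : ϖ ≠ 0 := uniformizer_ne_zero hd.vϖ
  have hϖ1 : Valued.v ϖ ≤ 1 := uniformizer_mem_integer hd.vϖ
  have hT := isTree_latticeGraph_three_of_unramified (K := K) hd
  have hroot : IsSelfDualLattice σ ϖ ((StdForm.antidiagonal 3).over K) (stdLattice K 3) := isSelfDualLattice_stdLattice_three hd
  have hnot : ∀ M : Submodule (Valued.integer K) (Fin 3 → K), IsVertexLattice σ ϖ ((StdForm.antidiagonal 3).over K) 2 M →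
      ¬ IsSelfDualLattice σ ϖ ((StdForm.antidiagonal 3).over K) M := fun M h2 => not_isSelfDualLattice_of_isVertexLattice_two hd h2
  -- the base edge `N₁ = g₁·L₀ < L₀`
  have hN₁ : mapGL g₁ (stdLattice K 3) = latt (Matrix.diagonal ![(1 : K), 1, ϖ]) := by rw [← hg₁]; rfl
  have hg₁2 : IsVertexLattice σ ϖ ((StdForm.antidiagonal 3).over K) 2 (mapGL g₁ (stdLattice K 3)) := by
    rw [hN₁]; exact isVertexLattice_two_latt_diagonal_one_one hd.σϖ hϖ1 hϖ0
  have hlt₁ : mapGL g₁ (stdLattice K 3) < stdLattice K 3 := by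
    have h := mapGL_N₁_lt_stdLattice hd (Subgroup.one_mem (unitaryInt σ ((StdForm.antidiagonal 3).over K)))
    rwa [Subgroup.coe_one, mapGL_one, ← hN₁] at h
  -- the three transitivities, for the unramified datum
  have hA : ∀ M : Submodule (Valued.integer K) (Fin 3 → K), IsSelfDualLattice σ ϖ ((StdForm.antidiagonal 3).over K) M →
      ∃ u : ↥(unitaryGroupOfForm σ ((StdForm.antidiagonal 3).over K)), mapGL (u : GL (Fin 3) K) (stdLattice K 3) = M := fun M hM =>
    exists_unitary_mapGL_stdLattice_eq_of_isSelfDualLattice_of_trace hd.σσ hd.vσ hd.vϖ hd.trace hM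
  have hB : ∀ M : Submodule (Valued.integer K) (Fin 3 → K), IsVertexLattice σ ϖ ((StdForm.antidiagonal 3).over K) 2 M →
      ∃ u : ↥(unitaryGroupOfForm σ ((StdForm.antidiagonal 3).over K)), mapGL ((u : GL (Fin 3) K) * g₁) (stdLattice K 3) = M := by
    intro M hM
    obtain ⟨u, hu⟩ := forall_isVertexLattice_two_exists_mapGL_N₁_eq hd M hM
    exact ⟨u, by rw [mapGL_mul, hN₁, hu]⟩
  have hI := forall_flag_exists_unitary hd g₁ hg₁
  obtain ⟨eA, -⟩ := exists_fixedBy_equiv_fixed_selfDual_rankN σ ϖ _ hroot hA γ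
  obtain ⟨eB, -⟩ := exists_fixedBy_conj_equiv_fixed_type σ ϖ _ hg₁2 hB γ
  obtain ⟨eI, -⟩ := exists_fixedBy_inf_equiv_fixed_flags_rankN σ ϖ _ hroot hg₁2 hlt₁ hI γ
  obtain ⟨eP⟩ := nonempty_fixed_flags_equiv_fixed_edges_three hd γ
  haveI : Finite (MulAction.fixedBy (↥(unitaryGroupOfForm σ ((StdForm.antidiagonal 3).over K)) ⧸
      (glInt 3 K).subgroupOf (unitaryGroupOfForm σ ((StdForm.antidiagonal 3).over K))) γ) := hK₀fin.to_subtype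
  haveI : Finite (MulAction.fixedBy (↥(unitaryGroupOfForm σ ((StdForm.antidiagonal 3).over K)) ⧸
      ((glInt 3 K).map (MulAut.conj g₁).toMonoidHom).subgroupOf (unitaryGroupOfForm σ ((StdForm.antidiagonal 3).over K))) γ) := hK₁fin.to_subtype
  have hfinA : {v : {M : Submodule (Valued.integer K) (Fin 3 → K) // IsVertex σ ϖ ((StdForm.antidiagonal 3).over K) M} |
      latticeGraphIso σ ϖ ((StdForm.antidiagonal 3).over K) γ v = v ∧ IsSelfDualLattice σ ϖ ((StdForm.antidiagonal 3).over K) v.1}.Finite :=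
    Set.finite_coe_iff.1 (Finite.of_equiv _ eA)
  have hfinB : {v : {M : Submodule (Valued.integer K) (Fin 3 → K) // IsVertex σ ϖ ((StdForm.antidiagonal 3).over K) M} |
      latticeGraphIso σ ϖ ((StdForm.antidiagonal 3).over K) γ v = v ∧ IsVertexLattice σ ϖ ((StdForm.antidiagonal 3).over K) 2 v.1}.Finite :=
    Set.finite_coe_iff.1 (Finite.of_equiv _ eB)
  have hunion : {v : {M : Submodule (Valued.integer K) (Fin 3 → K) // IsVertex σ ϖ ((StdForm.antidiagonal 3).over K) M} | latticeGraphIso σ ϖ ((StdForm.antidiagonal 3).over K) γ v = v} =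
      {v | latticeGraphIso σ ϖ ((StdForm.antidiagonal 3).over K) γ v = v ∧ IsSelfDualLattice σ ϖ ((StdForm.antidiagonal 3).over K) v.1} ∪
        {v | latticeGraphIso σ ϖ ((StdForm.antidiagonal 3).over K) γ v = v ∧ IsVertexLattice σ ϖ ((StdForm.antidiagonal 3).over K) 2 v.1} := by
    ext v
    simp only [Set.mem_setOf_eq, Set.mem_union]
    constructor
    · intro h
      obtain ⟨d, hvd⟩ := v.2
      rcases type_eq_zero_or_two_of_isVertexLattice_three hd.vσ hd.vϖ v_det_antidiagonal_three hvd with rfl | rfl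
      · exact Or.inl ⟨h, hvd⟩
      · exact Or.inr ⟨h, hvd⟩
    · rintro (⟨h, -⟩ | ⟨h, -⟩) <;> exact h
  have hfin : {v : {M : Submodule (Valued.integer K) (Fin 3 → K) // IsVertex σ ϖ ((StdForm.antidiagonal 3).over K) M} |
      latticeGraphIso σ ϖ ((StdForm.antidiagonal 3).over K) γ v = v}.Finite := by
    rw [hunion]
    exact hfinA.union hfinB
  obtain ⟨v₀, hv₀⟩ := exists_latticeGraphIso_apply_eq_self_three hd γ horb
  have hE := RootedTree.ncard_fixedPoints_eq_ncard_fixedEdges_add_one hT (latticeGraphIso σ ϖ ((StdForm.antidiagonal 3).over K) γ) hfin hv₀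
  rw [hunion, Set.ncard_union_eq (Set.disjoint_left.2 fun v hv hv' => hnot _ hv'.2 hv.2) hfinA hfinB] at hE
  rw [Nat.card_congr eA, Nat.card_congr eB, Nat.card_congr (eI.trans eP), Nat.card_coe_set_eq, Nat.card_coe_set_eq, hE, Nat.card_coe_set_eq]

end Three

end Literature.NumberTheory.Automorphic.UnitaryLatticeTree

end
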